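import Mathlib
import Summits.ValiantsHypothesis.ValiantsHypothesis.Theorems.NewtonUnitEquationsTwoProductsPlanarCellChargingBound
import Summits.ValiantsHypothesis.ValiantsHypothesis.Theorems.NewtonUnitEquationsTwoProductsPlanarCellTuranLite
import HarnessLib

/-!
# Crux `TwoProducts` (stmt-ValiantsHypothesis-5906), planar cells for GENERAL tails: the √coin law inside a two-slot frame

Theory lane (val-lit-p3 g13, CLAIM-FIRST #11; dossier HOME/lmr/DOSSIER-p3g13-5906-PlanarCell.md, statement T3).  Setting of
`card_clean_class_le` (p604128) / `planarCell_charged_frontier` (p606506): general tails supported in `A_j ∌ 0`, a cell family `S` with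
cell weight `ζ`, representations `rep l ∈ ∏(A_j ∪ {0})`, `Σ rep l = l`.  A FRAME is a tuple `b` with two free slots `j ≠ j'`; its family
`T ⊆ S` consists of the visible points of the class `{F(rep l) ≠ 0, F ≠ G}` whose representation agrees with `b` off `{j, j'}` — exactly the
fibres of the charging map of p604378 at `|U| = 2` (a "2-slot staircase").  THEOREM (`card_frame_le`):
  `(#T − 4)² ≤ 16 · frameCoin`,  `frameCoin := #{a ∈ ∏(A_i ∪ {0}) : Σ a multiply represented, a = b off {j, j'}}`,
i.e. `#T ≤ 4 + 4·√frameCoin`: the m = 2 law `visibleLeSqrtCoin` (p603417) transplanted into frames for every `m`.  Proof: order `T` by the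
`ζ`-weight of the slot-`j` letter; the CROSS TUPLE `cross x y = rep y [j ↦ rep x j]` of `x` above `y` outweighs `l_y` for every cell weight (one
letter heavier, ties allowed: then it differs from the strict top `l_y`), so `W` vanishes at its point; when that point is uniquely represented
this says `⟨φ x, ψ y⟩ = 0` for the RANK-TWO main term `φ x = (û_j(x_j), −v̂_j(x_j))`, `ψ y = (∏_{i≠j} û_i(y_i), ∏_{i≠j} v̂_i(y_i))`, while
`⟨φ x, ψ x⟩ = F(rep x) − G(rep x) ≠ 0`; hence a pairwise-good sub-family is linearly independent in `ℂ²` (`linearIndependent_of_triangular_le`),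
size `≤ 2`; Turán-lite (`sq_le_card_badPairs`) gives `(#T − 4)² ≤ 8·#bad ordered pairs`, and bad pairs inject (two orientations) into the
frame's multiply-represented tuples because a point of `T` is determined by its slot-`j` (or slot-`j'`) letter (two points agreeing off one
slot would dominate each other).  This replaces the multiplicity factor `s + 1` of `planarCell_charged(_frontier)` by `4 + 4√frameCoin` per frame.

Honest framing: no bound on `frameCoin` / `coinTuplesNear` is proved (dossier T2 is OPEN); `PlanarCross`, `PlanarCellBound`, the engine
and the crux `TwoProducts` are OPEN; `VP ≠ VNP` is NOT proved.  No named facts, no definitions. [folklore]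
-/

noncomputable section

-- Sub = Summit single-conjunct layout: the duplicated namespace component is mandated by the tree.
set_option linter.dupNamespace false

open scoped BigOperators
open MvPolynomial
open Summit.ValiantsHypothesis.ValiantsHypothesis.Theorems.NewtonUnitEquations.TwoProducts.FormalLogLinearisation

namespace Summit.ValiantsHypothesis.ValiantsHypothesis.Theorems.NewtonUnitEquations.TwoProducts.PlanarCell

variable {m : ℕ}

/-- A family of at most two linearly independent-able vectors: a finset `I` carrying a linearly independent family in `ℂ²` has
`#I ≤ 2`. [folklore] -/
theorem card_le_two_of_linearIndependent (I : Finset Expo) (φ : Expo → (Fin 2 → ℂ))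
    (h : LinearIndependent ℂ (fun x : I => φ x)) : I.card ≤ 2 := by
  have := h.fintype_card_le_finrank
  simpa [Module.finrank_fin_fun] using this

/-- **THE √COIN LAW IN A FRAME (general `m`).**  See the module docstring: `(#T − 4)² ≤ 16 · frameCoin`. [folklore] -/
theorem card_frame_le (u v : Fin m → MvPolynomial (Fin 2) ℂ) (A : Fin m → Finset Expo)
    (hA0 : ∀ j, (0 : Expo) ∉ A j) (huA : ∀ j, (u j).support ⊆ A j) (hvA : ∀ j, (v j).support ⊆ A j)
    (R : Expo → Expo → Prop) (S : Finset Expo)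
    (hS : ∀ l ∈ S, ∃ ξ : Fin 2 → ℝ, ValidWeight u v ξ ∧ IsStrictTop ξ (logSupport u v) l ∧
      ∀ e ∈ tailSupport u v, ∀ e' ∈ tailSupport u v, (R e e' ↔ wt ξ e ≤ wt ξ e'))
    (ζ : Fin 2 → ℝ) (hζval : ValidWeight u v ζ)
    (hRζ : ∀ e ∈ tailSupport u v, ∀ e' ∈ tailSupport u v, (R e e' ↔ wt ζ e ≤ wt ζ e'))
    (rep : Expo → Fin m → Expo) (hrepPF : ∀ l ∈ S, rep l ∈ Fintype.piFinset (fun j => insert 0 (A j)))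
    (hrepsum : ∀ l ∈ S, ∑ j, rep l j = l)
    (j j' : Fin m) (hjj : j ≠ j') (b : Fin m → Expo) (T : Finset Expo) (hTS : T ⊆ S)
    (hTF : ∀ l ∈ T, ∏ i, hatCoeff (u i) (rep l i) ≠ 0 ∧
      ∏ i, hatCoeff (u i) (rep l i) ≠ ∏ i, hatCoeff (v i) (rep l i))
    (hTb : ∀ l ∈ T, ∀ i, i ≠ j → i ≠ j' → rep l i = b i) :
    (T.card - 4) * (T.card - 4) ≤
      16 * ((Fintype.piFinset (fun j => insert (0 : Expo) (A j))).filter fun a =>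
        (∃ c ∈ Fintype.piFinset (fun j => insert (0 : Expo) (A j)), c ≠ a ∧ ∑ i, c i = ∑ i, a i) ∧
          ∀ i, i ≠ j → i ≠ j' → a i = b i).card := by
  classical
  set PF := Fintype.piFinset (fun j => insert (0 : Expo) (A j)) with hPF
  set E := tailSupport u v with hE
  set D := PF.filter (fun a => (∃ c ∈ PF, c ≠ a ∧ ∑ i, c i = ∑ i, a i) ∧ ∀ i, i ≠ j → i ≠ j' → a i = b i)
    with hD
  have hu0 : ∀ j, coeff 0 (u j) = 0 := fun j => notMem_support_iff.1 fun h => hA0 j (huA j h)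
  have hv0 : ∀ j, coeff 0 (v j) = 0 := fun j => notMem_support_iff.1 fun h => hA0 j (hvA j h)
  choose! ξ hval htop hRξ using hS
  have htopW : ∀ l ∈ S, IsStrictTop (ξ l) ↑(tailDiff u v).support l := fun l hl =>
    (stub_logLinearisation m u v hu0 hv0 (ξ l) (hval l hl) l).2 (htop l hl)
  have hTS' : ∀ l ∈ T, l ∈ S := fun l hl => hTS hl
  -- letters of points of `T` are `0` or tail exponents
  have hE_of : ∀ (i : Fin m) (e : Expo), hatCoeff (u i) e ≠ 0 → e = 0 ∨ e ∈ E := by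
    intro i e hne
    by_cases he : e = 0
    · exact Or.inl he
    · right
      simp only [hatCoeff, he, if_false] at hne
      exact Finset.mem_union_left _ (Finset.mem_biUnion.2 ⟨i, Finset.mem_univ _, mem_support_iff.2 hne⟩)
  have hletter : ∀ l ∈ T, ∀ i, rep l i = 0 ∨ rep l i ∈ E := fun l hl i =>
    hE_of i _ ((Finset.prod_ne_zero_iff.1 (hTF l hl).1) i (Finset.mem_univ _))
  -- comparisons of letters transfer from `ζ` to every witness, `0` on top
  have hwt0 : ∀ (η : Fin 2 → ℝ), wt η 0 = 0 := fun η => by simp [wt]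
  have hval_neg : ∀ l ∈ S, ∀ e ∈ E, wt (ξ l) e < 0 := by
    intro l hl e he
    rcases Finset.mem_union.1 he with h | h
    · obtain ⟨j, -, hj⟩ := Finset.mem_biUnion.1 h
      exact (hval l hl).1 j e hj
    · obtain ⟨j, -, hj⟩ := Finset.mem_biUnion.1 h
      exact (hval l hl).2 j e hj
  have hζ_neg : ∀ e ∈ E, wt ζ e < 0 := by
    intro e he
    rcases Finset.mem_union.1 he with h | h
    · obtain ⟨j, -, hj⟩ := Finset.mem_biUnion.1 h
      exact hζval.1 j e hj
    · obtain ⟨j, -, hj⟩ := Finset.mem_biUnion.1 h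
      exact hζval.2 j e hj
  have transfer : ∀ l ∈ S, ∀ p q : Expo, (p = 0 ∨ p ∈ E) → (q = 0 ∨ q ∈ E) →
      wt ζ q ≤ wt ζ p → wt (ξ l) q ≤ wt (ξ l) p := by
    intro l hl p q hp hq hle
    rcases hp with rfl | hp
    · rcases hq with rfl | hq
      · exact le_rfl
      · rw [hwt0]; exact (hval_neg l hl q hq).le
    · rcases hq with rfl | hq
      · exfalso
        rw [hwt0] at hle
        linarith [hζ_neg p hp]
      · exact (hRξ l hl q hq p hp).1 ((hRζ q hq p hp).2 hle)
  -- the weight of a point of `S` is the sum of the weights of its letters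
  have hwt_rep : ∀ (η : Fin 2 → ℝ), ∀ l ∈ S, wt η l = ∑ j, wt η (rep l j) := by
    intro η l hl
    conv_lhs => rw [← hrepsum l hl]
    exact wt_sum η _ _
  -- cancellation with ties: a tuple letterwise no lighter than `rep l` whose point is not `l` lies outside `supp W`
  have hcancel : ∀ l ∈ T, ∀ a' : Fin m → Expo, (∀ i, a' i = 0 ∨ a' i ∈ E) → (∀ i, wt ζ (rep l i) ≤ wt ζ (a' i)) →
      (∑ i, a' i) ≠ l → coeff (∑ i, a' i) (tailDiff u v) = 0 := by
    intro l hl a' hE' hle hne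
    have hlS := hTS' l hl
    have hge : wt (ξ l) l ≤ wt (ξ l) (∑ i, a' i) := by
      rw [hwt_rep (ξ l) l hlS, wt_sum]
      exact Finset.sum_le_sum fun i _ => transfer l hlS (a' i) (rep l i) (hE' i) (hletter l hl i) (hle i)
    by_contra h
    have hmem : (∑ i, a' i) ∈ ((tailDiff u v).support : Set Expo) := mem_support_iff.2 h
    have := (htopW l hlS).2 _ hmem hne
    exact absurd hge (not_le.2 this)
  -- two points of `T` never dominate each other letterwise
  have hnodom : ∀ l ∈ T, ∀ l' ∈ T, l ≠ l' → ∃ i, wt ζ (rep l i) < wt ζ (rep l' i) := by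
    intro l hl l' hl' hne
    by_contra hno
    push Not at hno
    have hge : wt (ξ l') l' ≤ wt (ξ l') l := by
      rw [hwt_rep (ξ l') l (hTS' l hl), hwt_rep (ξ l') l' (hTS' l' hl')]
      exact Finset.sum_le_sum fun i _ =>
        transfer l' (hTS' l' hl') (rep l i) (rep l' i) (hletter l hl i) (hletter l' hl' i) (hno i)
    have hsupp : l ∈ ((tailDiff u v).support : Set Expo) := (htopW l (hTS' l hl)).1
    have := (htopW l' (hTS' l' hl')).2 l hsupp hne
    exact absurd hge (not_le.2 this)
  -- a point of the frame family is determined by its slot-`j` letter, and by its slot-`j'` letter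
  have hone : ∀ (k k' : Fin m), k ≠ k' → (∀ l ∈ T, ∀ i, i ≠ k → i ≠ k' → rep l i = b i) →
      ∀ x ∈ T, ∀ y ∈ T, rep x k = rep y k → x = y := by
    intro k k' hkk hb x hx y hy hk
    by_contra hxy
    have hagree : ∀ i, i ≠ k' → rep x i = rep y i := by
      intro i hi
      by_cases hik : i = k
      · rw [hik]; exact hk
      · rw [hb x hx i hik hi, hb y hy i hik hi]
    obtain ⟨i₁, h₁⟩ := hnodom x hx y hy hxy
    obtain ⟨i₂, h₂⟩ := hnodom y hy x hx (Ne.symm hxy)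
    have hi₁ : i₁ = k' := by
      by_contra h; rw [hagree i₁ h] at h₁; exact lt_irrefl _ h₁
    have hi₂ : i₂ = k' := by
      by_contra h; rw [hagree i₂ h] at h₂; exact lt_irrefl _ h₂
    subst hi₁; rw [hi₂] at h₂
    exact lt_asymm h₁ h₂
  have hone_j : ∀ x ∈ T, ∀ y ∈ T, rep x j = rep y j → x = y := hone j j' hjj hTb
  have hone_j' : ∀ x ∈ T, ∀ y ∈ T, rep x j' = rep y j' → x = y :=
    hone j' j hjj.symm (fun l hl i hi hi' => hTb l hl i hi' hi)
  -- cross tuples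
  let cross : Expo → Expo → (Fin m → Expo) := fun x y => Function.update (rep y) j (rep x j)
  have hcrossPF : ∀ x ∈ T, ∀ y ∈ T, cross x y ∈ PF := by
    intro x hx y hy
    rw [hPF, Fintype.mem_piFinset]
    intro i
    by_cases hi : i = j
    · subst hi; simp only [cross, Function.update_self]
      exact Fintype.mem_piFinset.1 (hPF ▸ hrepPF x (hTS' x hx)) i
    · simp only [cross, Function.update_of_ne hi]
      exact Fintype.mem_piFinset.1 (hPF ▸ hrepPF y (hTS' y hy)) i
  have hcross_b : ∀ x ∈ T, ∀ y ∈ T, ∀ i, i ≠ j → i ≠ j' → cross x y i = b i := by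
    intro x hx y hy i hi hi'
    simp only [cross, Function.update_of_ne hi]
    exact hTb y hy i hi hi'
  have hcross_j : ∀ x y, cross x y j = rep x j := fun x y => by simp [cross]
  have hcross_j' : ∀ x y, cross x y j' = rep y j' := fun x y => by
    simp only [cross, Function.update_of_ne hjj.symm]
  have hcross_inj : ∀ x ∈ T, ∀ y ∈ T, ∀ x' ∈ T, ∀ y' ∈ T, cross x y = cross x' y' → x = x' ∧ y = y' := by
    intro x hx y hy x' hx' y' hy' h
    refine ⟨hone_j x hx x' hx' ?_, hone_j' y hy y' hy' ?_⟩
    · rw [← hcross_j x y, ← hcross_j x' y', h]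
    · rw [← hcross_j' x y, ← hcross_j' x' y', h]
  -- the rank-two main term
  let φ : Expo → (Fin 2 → ℂ) := fun x => ![hatCoeff (u j) (rep x j), -hatCoeff (v j) (rep x j)]
  let ψ : Expo → (Fin 2 → ℂ) := fun y =>
    ![∏ i ∈ Finset.univ.erase j, hatCoeff (u i) (rep y i), ∏ i ∈ Finset.univ.erase j, hatCoeff (v i) (rep y i)]
  have hmain : ∀ x y, φ x ⬝ᵥ ψ y =
      ∏ i, hatCoeff (u i) (cross x y i) - ∏ i, hatCoeff (v i) (cross x y i) := by
    intro x y
    simp only [φ, ψ, cross, prod_hatCoeff_update, dotProduct, Fin.sum_univ_two, Matrix.cons_val_zero,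
      Matrix.cons_val_one]
    ring
  have hdiag : ∀ x ∈ T, φ x ⬝ᵥ ψ x ≠ 0 := by
    intro x hx
    rw [hmain]
    simp only [cross, Function.update_eq_self]
    exact sub_ne_zero.2 (hTF x hx).2
  -- above the diagonal, at a uniquely represented cross point, the main term vanishes
  have hzero : ∀ x ∈ T, ∀ y ∈ T, x ≠ y → wt ζ (rep y j) ≤ wt ζ (rep x j) →
      (∀ c ∈ PF, ∑ i, c i = ∑ i, cross x y i → c = cross x y) → φ x ⬝ᵥ ψ y = 0 := by
    intro x hx y hy hxy hle huniq
    rw [hmain, ← coeff_tailDiff_of_uniq u v A hA0 huA hvA (hPF ▸ hcrossPF x hx y hy) (hPF ▸ huniq)]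
    refine hcancel y hy (cross x y) (fun i => ?_) (fun i => ?_) ?_
    · by_cases hi : i = j
      · subst hi; rw [hcross_j]; exact hletter x hx _
      · simp only [cross, Function.update_of_ne hi]; exact hletter y hy i
    · by_cases hi : i = j
      · subst hi; rw [hcross_j]; exact hle
      · simp only [cross, Function.update_of_ne hi]; exact le_rfl
    · intro heq
      apply hxy
      apply hone_j x hx y hy
      have h1 : ∑ i, cross x y i = rep x j + ∑ i ∈ Finset.univ.erase j, rep y i := sum_update_eq _ _ _
      have h2 : y = rep y j + ∑ i ∈ Finset.univ.erase j, rep y i := by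
        conv_lhs => rw [← hrepsum y (hTS' y hy)]
        exact (Finset.add_sum_erase _ _ (Finset.mem_univ j)).symm
      have := h1.symm.trans (heq.trans h2)
      exact add_right_cancel this
  -- bad pairs: a cross tuple (in either orientation) is multiply represented
  let Mult : (Fin m → Expo) → Prop := fun a => ∃ c ∈ PF, c ≠ a ∧ ∑ i, c i = ∑ i, a i
  let bad : Expo → Expo → Prop := fun x y => Mult (cross x y) ∨ Mult (cross y x)
  have hbad_symm : ∀ x y, bad x y → bad y x := fun x y h => h.symm
  -- good sub-families have at most two (hence at most four) points
  have hgood : ∀ I ⊆ T, (∀ x ∈ I, ∀ y ∈ I, x ≠ y → ¬ bad x y) → I.card ≤ 4 := by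
    intro I hIT hI
    refine (card_le_two_of_linearIndependent I φ ?_).trans (by norm_num)
    refine linearIndependent_of_triangular_le (fun x : I => wt ζ (rep x j)) (fun x : I => φ x) (fun x : I => ψ x)
      (fun x y hxy hle => ?_) (fun x => hdiag x (hIT x.2))
    have hxy' : (x : Expo) ≠ y := fun h => hxy (Subtype.ext h)
    have hnb := hI x x.2 y y.2 hxy'
    refine hzero x (hIT x.2) y (hIT y.2) hxy' hle fun c hc hsum => ?_
    by_contra hne
    exact hnb (Or.inl ⟨c, hc, hne, hsum⟩)
  have hturan := sq_le_card_badPairs bad hbad_symm T hgood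
  -- bad ordered pairs inject (twice) into the frame's multiply-represented tuples
  have hB : ((T ×ˢ T).filter fun p => p.1 ≠ p.2 ∧ bad p.1 p.2).card ≤ 2 * D.card := by
    have hsub : ((T ×ˢ T).filter fun p => p.1 ≠ p.2 ∧ bad p.1 p.2) ⊆
        ((T ×ˢ T).filter fun p => Mult (cross p.1 p.2)) ∪ ((T ×ˢ T).filter fun p => Mult (cross p.2 p.1)) := by
      intro p hp
      rw [Finset.mem_filter] at hp
      rw [Finset.mem_union, Finset.mem_filter, Finset.mem_filter]
      rcases hp.2.2 with h | h
      · exact Or.inl ⟨hp.1, h⟩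
      · exact Or.inr ⟨hp.1, h⟩
    have hmemD : ∀ x ∈ T, ∀ y ∈ T, Mult (cross x y) → cross x y ∈ D := by
      intro x hx y hy hM
      rw [hD, Finset.mem_filter]
      exact ⟨hcrossPF x hx y hy, hM, hcross_b x hx y hy⟩
    have h1 : ((T ×ˢ T).filter fun p => Mult (cross p.1 p.2)).card ≤ D.card := by
      refine Finset.card_le_card_of_injOn (fun p => cross p.1 p.2) (fun p hp => ?_) (fun p hp p' hp' h => ?_)
      · rw [Finset.mem_coe, Finset.mem_filter, Finset.mem_product] at hp
        exact hmemD _ hp.1.1 _ hp.1.2 hp.2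
      · rw [Finset.mem_coe, Finset.mem_filter, Finset.mem_product] at hp hp'
        obtain ⟨h₁, h₂⟩ := hcross_inj _ hp.1.1 _ hp.1.2 _ hp'.1.1 _ hp'.1.2 h
        exact Prod.ext h₁ h₂
    have h2 : ((T ×ˢ T).filter fun p => Mult (cross p.2 p.1)).card ≤ D.card := by
      refine Finset.card_le_card_of_injOn (fun p => cross p.2 p.1) (fun p hp => ?_) (fun p hp p' hp' h => ?_)
      · rw [Finset.mem_coe, Finset.mem_filter, Finset.mem_product] at hp
        exact hmemD _ hp.1.2 _ hp.1.1 hp.2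
      · rw [Finset.mem_coe, Finset.mem_filter, Finset.mem_product] at hp hp'
        obtain ⟨h₁, h₂⟩ := hcross_inj _ hp.1.2 _ hp.1.1 _ hp'.1.2 _ hp'.1.1 h
        exact Prod.ext h₂ h₁
    calc _ ≤ (((T ×ˢ T).filter fun p => Mult (cross p.1 p.2)) ∪
          ((T ×ˢ T).filter fun p => Mult (cross p.2 p.1))).card := Finset.card_le_card hsub
      _ ≤ _ := Finset.card_union_le _ _
      _ ≤ D.card + D.card := Nat.add_le_add h1 h2
      _ = 2 * D.card := by ring
  calc (T.card - 4) * (T.card - 4) ≤ 8 * ((T ×ˢ T).filter fun p => p.1 ≠ p.2 ∧ bad p.1 p.2).card := hturan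
    _ ≤ 8 * (2 * D.card) := Nat.mul_le_mul_left _ hB
    _ = 16 * D.card := by ring

end Summit.ValiantsHypothesis.ValiantsHypothesis.Theorems.NewtonUnitEquations.TwoProducts.PlanarCell

end
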